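import Literature.ModelTheory.ExponentialFields.DefinableAlgebraicNumbersHolds
import HarnessLib

/-!
# KMO 2012, §3.5 Proposition in every universe: `KMO2012_automorphismExtension` holds

J. Kirby, A. Macintyre, A. Onshuus, *The algebraic numbers definable in various exponential
fields*, J. Inst. Math. Jussieu 11 (2012) 825–834 (arXiv:1101.4224), §3.5, Proposition: *in a
Zilber field with CCP every automorphism of a finitely generated partial E-subfield `F₀ ◁ F`
containing `SK` extends to an automorphism of `F`* — "This follows from the quasiminimal excellence
of the class of Zilber fields and Theorem 3.3 in [K3]" (J. Kirby, *On quasiminimal excellent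
classes*, J. Symbolic Logic 75 (2010)).

Third proofs file of the named fact `KMO2012_automorphismExtension`
(`DefinableAlgebraicNumbers.lean`). `DefinableAlgebraicNumbersHolds.lean` translates the fact into
the Γ-field vocabulary (`KMO2012.kmo_of_gammaForm`: it follows from a "Γ-form" extension principle
`hmain` for the field) and proves the countable case (`KMO2012.automorphismExtension_of_countable`,
Kirby 2010 Thm 2.1 / Prop. 2.3) and the instance in `Type`
(`KMO2012_automorphismExtension_of_type_zero`). The Γ-form principle itself is proved for every
Zilber field in every universe in
`Literature/NumberTheory/Transcendental/ZilberFieldAutomorphismsUncountable.lean`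
(`ZilberAutomorphisms.exists_equiv_of_isGammaIsoTw₂₀`: countable fields by Kirby 2010 Thm 2.1 /
Prop. 2.3; uncountable fields by hull to closure, `ZilberAutomorphisms.exists_isEIsoOn_of_isGammaIsoTw₂`,
and closure to the field, `ZilberAutomorphisms.exists_equiv_of_isEIsoOn_of_uncountable` = Kirby 2010
Thm 3.3 in the quasiminimal pregeometry class `ZilberClosedClassOver (ecl ∅)`), and this file only
records the consequence:

* `KMO2012_automorphismExtension_holds` — **the named fact, proved in every universe**
  (`kmo_of_gammaForm` fed with `ZilberAutomorphisms.exists_equiv_of_isGammaIsoTw₂₀`). Net debt −1.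

(Earlier revisions of this file re-proved the two uncountable steps here as
`KMO2012.exists_equiv_extend_isEIsoOn` and `KMO2012.gammaForm_of_uncountable`; they were literal
duplicates of `ZilberAutomorphisms.exists_equiv_of_isEIsoOn_of_uncountable` and
`ZilberAutomorphisms.exists_equiv_of_isGammaIsoTw₂₀` once that file became universe polymorphic, and
have been removed in their favour.)

## References

* J. Kirby, A. Macintyre, A. Onshuus, J. Inst. Math. Jussieu 11 (2012) 825–834, arXiv:1101.4224:
  §3.5 Proposition.
* J. Kirby, *On quasiminimal excellent classes*, J. Symbolic Logic 75 (2010) 551–564: Thm 2.1,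
  Prop. 2.3, Thm 3.3.
* M. Bays, J. Kirby, Algebra & Number Theory 12 (2018) 493–549: Lemma 8.3, Thm 9.1.
-/

noncomputable section

namespace Literature.ModelTheory.ExponentialFields

open Literature.NumberTheory.Transcendental

namespace KMO2012

/-! ### The named fact, in every universe -/

/-- **Kirby–Macintyre–Onshuus 2012, §3.5 Proposition — the named fact
`KMO2012_automorphismExtension` HOLDS, in every universe**: in a Zilber field (with CCP) every
automorphism of a finitely generated partial E-subfield `F₀ ◁ F` containing `SK` extends to an
automorphism of the exponential field `F`. Proof: the translation `kmo_of_gammaForm` fed with the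
Γ-form extension principle `ZilberAutomorphisms.exists_equiv_of_isGammaIsoTw₂₀` (countable fields:
Kirby 2010 Thm 2.1 / Prop. 2.3; uncountable fields: Kirby 2010 Thm 2.1 + Thm 3.3, "quasiminimal
excellence of the class of Zilber fields"). [cite: KirbyMacintyreOnshuus2012, §3.5 Proposition]
[cite: Kirby2010QMEC, Thm 2.1, Prop. 2.3 and Thm 3.3] -/
theorem _root_.Literature.ModelTheory.ExponentialFields.KMO2012_automorphismExtension_holds :
    KMO2012_automorphismExtension :=
  fun _ _ _ _ hF F₀ D hDF₀ hexpF₀ hkerD hfg hstrong σ hσD hσexp =>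
    kmo_of_gammaForm hF
      (fun hk₁ hk₂ h₁ h₂ _ hσ₀ _ _ _ hiso hs hs' =>
        ZilberAutomorphisms.exists_equiv_of_isGammaIsoTw₂₀ hF hk₁ hk₂ h₁ h₂ hσ₀ hiso hs hs')
      F₀ D hDF₀ hexpF₀ hkerD hfg hstrong σ hσD hσexp

end KMO2012

end Literature.ModelTheory.ExponentialFields

end
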